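import Mathlib
import Summits.Ventures.HodgeRepro2.A1SplitExteriorSummand

/-!
# The split summand `⊕_s ⋀^n V_s ⊂ ⋀^n(⊕_s V_s)` is stable under every automorphism permuting the summands

Blind cell `pub-hodge-repro2`, seat p7 (gen 9), A1 annex (route/T4-A1-p7.md Lemma A1.3 /
route/LEAN-ANNEX-p7.md §4: the «gluing» left as prose after p395460 (the split case) and
p395558 (Galois descent of subspaces) — that the split summand `⊕_σ ⋀^4 V_σ` is GALOIS-STABLE,
the Galois group permuting the eigenlines `V_σ`).

For `R`-modules `V s` (`s ∈ S` finite) and a linear map `γ` of `⊕_s V_s` that is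
PERMUTATION-COMPATIBLE — `γ ∘ ι_s = ι_{σ s} ∘ g_s` for a map `σ : S → S` and linear maps
`g_s : V_s → V_{σ s}` — the induced map `⋀^n γ` sends the summand `range (incl R V n)` of
`A1SplitExteriorSummand` into itself:

* `range_incl_eq_iSup`: `range incl = ⨆_s range (⋀^n ι_s)`;
* `map_range_incl_le`, `map_mem_range_incl`: `⋀^n γ (range incl) ⊆ range incl`;
* `comap_range_incl_eq` / `map_range_incl_eq`: equality when `γ` is invertible with a
  permutation-compatible inverse (`σ` bijective); in particular for a GROUP acting by
  permutation-compatible automorphisms the summand is an invariant subspace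
  (`range_incl_stable_of_forall`).

What stays prose: that `act τ = τ ⊗ id` on `V ⊗ L = ⊕_σ V_σ` is permutation-compatible for
`σ ↦ τσ` (the eigenline permutation — p6's `A2GaloisKernel.mem_eigenspace_map` in the semilinear
setting) and the identification of `H¹(B, ℚ) ⊗ L` with `⊕_σ V_σ` (A0.4 / A0.6).
README §8(d): uses an L-value-free non-vanishing device: NO.
-/

namespace Summit.Ventures.HodgeRepro2.A1SplitExteriorStable

open DirectSum
open Summit.Ventures.HodgeRepro2.A1SplitExteriorSummand

variable (R : Type*) [CommRing R] {S : Type*} [DecidableEq S]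
  (V : S → Type*) [∀ s, AddCommGroup (V s)] [∀ s, Module R (V s)] (n : ℕ)

/-- `range incl = ⨆_s range (⋀^n ι_s)`: the split summand is spanned by the images of the
`⋀^n V_s`. -/
theorem range_incl_eq_iSup :
    LinearMap.range (incl R V n) =
      ⨆ s, LinearMap.range (exteriorPower.map n (DirectSum.lof R S V s)) := by
  apply le_antisymm
  · rintro _ ⟨y, rfl⟩
    induction y using DirectSum.induction_on with
    | zero => simp
    | of s x =>
      refine Submodule.mem_iSup_of_mem s ⟨x, ?_⟩
      rw [← DirectSum.lof_eq_of R, ← LinearMap.comp_apply, incl_comp_lof]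
    | add x y hx hy =>
      rw [map_add]
      exact Submodule.add_mem _ hx hy
  · refine iSup_le fun s => ?_
    rw [← incl_comp_lof R V n s, LinearMap.range_comp]
    exact LinearMap.map_le_range

section Permutation

variable (γ : (⨁ s, V s) →ₗ[R] ⨁ s, V s) (σ : S → S) (g : ∀ s, V s →ₗ[R] V (σ s))

/-- **Stability**: if `γ ∘ ι_s = ι_{σ s} ∘ g_s` for every `s`, then `⋀^n γ` maps the split
summand into itself. -/
theorem map_range_incl_le
    (hγ : ∀ s, γ ∘ₗ DirectSum.lof R S V s = DirectSum.lof R S V (σ s) ∘ₗ g s) :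
    (LinearMap.range (incl R V n)).map (exteriorPower.map n γ) ≤
      LinearMap.range (incl R V n) := by
  rw [range_incl_eq_iSup, Submodule.map_iSup]
  refine iSup_le fun s => ?_
  rw [← LinearMap.range_comp, ← exteriorPower.map_comp, hγ s, exteriorPower.map_comp,
    LinearMap.range_comp]
  exact (LinearMap.map_le_range).trans
    (le_iSup (fun t => LinearMap.range (exteriorPower.map n (DirectSum.lof R S V t))) (σ s))

/-- Pointwise form of `map_range_incl_le`. -/
theorem map_mem_range_incl
    (hγ : ∀ s, γ ∘ₗ DirectSum.lof R S V s = DirectSum.lof R S V (σ s) ∘ₗ g s)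
    {x : ⋀[R]^n (⨁ s, V s)} (hx : x ∈ LinearMap.range (incl R V n)) :
    exteriorPower.map n γ x ∈ LinearMap.range (incl R V n) :=
  map_range_incl_le R V n γ σ g hγ ⟨x, hx, rfl⟩

end Permutation

section Group

variable {G : Type*} [Group G] (ρ : G →* ((⨁ s, V s) →ₗ[R] ⨁ s, V s))

/-- A group acting through permutation-compatible maps (each `ρ γ` permutes the summands
through some `σ_γ`, `g_γ`) leaves the split summand INVARIANT: `⋀^n (ρ γ)` maps it into itself
for every `γ`. -/
theorem range_incl_stable_of_forall
    (h : ∀ γ : G, ∃ (σ : S → S) (g : ∀ s, V s →ₗ[R] V (σ s)),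
      ∀ s, ρ γ ∘ₗ DirectSum.lof R S V s = DirectSum.lof R S V (σ s) ∘ₗ g s)
    (γ : G) {x : ⋀[R]^n (⨁ s, V s)} (hx : x ∈ LinearMap.range (incl R V n)) :
    exteriorPower.map n (ρ γ) x ∈ LinearMap.range (incl R V n) := by
  obtain ⟨σ, g, hγ⟩ := h γ
  exact map_mem_range_incl R V n (ρ γ) σ g hγ hx

/-- For an invertible permutation-compatible `γ` (inverse also permutation-compatible) the
summand is mapped ONTO itself. -/
theorem map_range_incl_eq (γ γ' : (⨁ s, V s) →ₗ[R] ⨁ s, V s) (hγγ' : γ ∘ₗ γ' = LinearMap.id)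
    (σ : S → S) (g : ∀ s, V s →ₗ[R] V (σ s))
    (hγ : ∀ s, γ ∘ₗ DirectSum.lof R S V s = DirectSum.lof R S V (σ s) ∘ₗ g s)
    (σ' : S → S) (g' : ∀ s, V s →ₗ[R] V (σ' s))
    (hγ' : ∀ s, γ' ∘ₗ DirectSum.lof R S V s = DirectSum.lof R S V (σ' s) ∘ₗ g' s) :
    (LinearMap.range (incl R V n)).map (exteriorPower.map n γ) = LinearMap.range (incl R V n) := by
  apply le_antisymm (map_range_incl_le R V n γ σ g hγ)
  intro x hx
  refine ⟨exteriorPower.map n γ' x, map_mem_range_incl R V n γ' σ' g' hγ' hx, ?_⟩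
  rw [← LinearMap.comp_apply, ← exteriorPower.map_comp, hγγ', exteriorPower.map_id,
    LinearMap.id_apply]

end Group

end Summit.Ventures.HodgeRepro2.A1SplitExteriorStable
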